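import Literature.MathematicalPhysics.QuantumLattice.SchwartzFourierDensity
import Literature.MathematicalPhysics.QuantumLattice.SchwartzTensorDensity
import Literature.MathematicalPhysics.QuantumLattice.SchwartzReIm
import Literature.MathematicalPhysics.QuantumLattice.SchwartzTranslationCutoff
import Mathlib.Analysis.Calculus.BumpFunction.FiniteDimension
import Mathlib.Topology.Algebra.Module.FiniteDimension
import HarnessLib

/-!
# Density of tensor products of test functions: proofs

Trunk **T-AQFT** (topic `MathematicalPhysics/QuantumLattice`), families `constructive-qft`,
`crit-ising`; the proofs file of `SchwartzTensorDensity` and of the density fact of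
`SchwingerOSAxioms`, in the decomposition of the bridge `Literature.MathematicalPhysics.QuantumLattice.IsOSMeasure.exists_isOSFamily`
/ `exists_isOSFamily'` (measure-form OS axioms ⇒ distributional OS axioms).

Discharged named facts:

* `Literature.MathematicalPhysics.QuantumLattice.denseSpan_tensorProducts` (`SchwingerOSAxioms`; Reed–Simon I, Thm V.13; OS 1973 §2,
  `𝒮(ℝ^{4n}) = ⊗̂ⁿ 𝒮(ℝ⁴)`): for a finite-dimensional real normed space `E`, the `ℂ`-span of the
  tensor products `f₁ ⊗ ⋯ ⊗ fₙ` of complexified real test functions is dense in `𝓢(Eⁿ, ℂ)` —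
  `denseSpan_tensorProducts_holds`; whence the E3 and E1 bridges and the uniqueness of the
  Schwinger family (`IsSchwingerFamilyOf.isSymmetric_holds`,
  `IsSchwingerFamilyOf.isEuclideanCovariant_holds`, `IsSchwingerFamilyOf.unique`).
* `Literature.MathematicalPhysics.QuantumLattice.IsPositiveTimeMulti.mem_closure_span_positiveTensorProducts` (`SchwartzTensorDensity`;
  OS 1973 §2 pp. 86–87, `𝒮(ℝ^{4n}₊) = ⊗̂ₙ 𝒮(ℝ⁴₊)`, open-wedge variant): every `n`-point test
  function supported in `{∀ i, xᵢ⁰ > 0}` lies in the closure of the span of tensor products of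
  real one-point test functions supported at positive times —
  `IsPositiveTimeMulti.mem_closure_span_positiveTensorProducts_holds`.

## Proof

1. *Local density theorem* (`mem_closure_span_boxTensors`). Fix linear coordinates
   `Λ : E ≃ ℝᵐ` and nested boxes in the block coordinates `Λ(vᵢ)_c` of `v ∈ Eⁿ`: an inner closed
   box `∏ [l'_{ic}, u'_{ic}]` strictly inside an outer open box `∏ (l_{ic}, u_{ic})` (`BoxData`). If
   `tsupport F` lies in the inner box, then in the affine coordinates `y = A v + w` sending the
   outer box onto the unit cube (`boxCoord`, `boxShift`) `F` is supported in `[δ, 1-δ]^{n m}`; with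
   the product cutoff `P = ⊗ᵢ Pᵢ`, `Pᵢ(x) = ∏_c χ_{ic}(Λ(x)_c)` (`ContDiffBump`s equal to `1` on
   `[l', u']` and supported in `(l, u)`), the engine `tendsto_sum_boxCoeff_smul`
   (`SchwartzFourierDensity`) gives `∑_{n ∈ s} 𝓕(⋯)(n) · Q_n → F` in `𝓢`, where
   `Q_n(v) = P(v) e^{2πi n·(Av+w)} = ∏ᵢ qᵢ(vᵢ)`, `qᵢ = Pᵢ e^{2πi θᵢ}` (`charTerm_apply`, characters
   of sums are products). Each `Q_n = ⊗ᵢ qᵢ` is a tensor product of complex compactly supported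
   test functions, hence a combination of `2ⁿ` tensor products of the real test functions
   `re qᵢ`, `im qᵢ` (`eq_sum_tensorFin_reIm` of `SchwartzReIm`), all supported in the blocks of the
   outer box (`charTerm_mem_span`). So the partial sums lie in the span and `F` in its closure.
2. *`denseSpan_tensorProducts`*: compactly supported test functions are dense
   (`exists_tsupport_subset_closedBall_tendsto`, `SchwartzTranslationCutoff`); a function supported
   in a ball is supported in a box; apply 1 and forget the supports.
3. *Positive time*: for `F` supported in the open wedge, the forward time translates
   `F_T = F(· - T e₀)` (all arguments) converge to `F` as `T → 0` (`continuous_compSubConstCLM`)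
   and are supported in `{∀ i, xᵢ⁰ ≥ T}`; their compact cutoffs
   (`exists_tsupport_subset_inter_closedBall_tendsto`, supported inside `tsupport F_T`) are
   supported in closed boxes with `xᵢ⁰ ∈ [T, R]`, strictly inside open boxes with `xᵢ⁰ > T/2`;
   apply 1 with `Λ = id`: the real factors are supported in `{x⁰ > T/2}`, i.e. positive-time.
   (No vanishing-to-infinite-order/Taylor argument at the boundary of the wedge is needed.)

## Sources

* K. Osterwalder, R. Schrader, *Axioms for Euclidean Green's functions*, Comm. Math. Phys. 31
  (1973) 83–112, §2 pp. 86–87. [OsterwalderSchraderCMP1973]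
* M. Reed, B. Simon, *Methods of Modern Mathematical Physics I* (1980), Thm V.13. [ReedSimonI1980]
* The Fourier-series proof of the density of `C_c^∞(X) ⊗ C_c^∞(Y)` in `C_c^∞(X × Y)` is
  textbook folklore (e.g. the proof of the Schwartz kernel theorem).

## Mathlib

Used: `ContDiffBump`, `HasCompactSupport.toSchwartzMap`, `LinearEquiv.toContinuousLinearEquiv`,
`ContinuousLinearEquiv.ofFinrankEq`, `EuclideanSpace.equiv`, `Homeomorph.isCompact_preimage`,
`isCompact_univ_pi`, `AddChar.map_add_eq_mul` (characters), `mem_closure_of_tendsto`,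
`IsClosed.mem_of_tendsto`, `dense_iff_closure_eq`. Searched and absent at the pin: any density
statement for tensor products in `SchwartzMap`.
-/

open scoped SchwartzMap Real FourierTransform Topology
open Filter Set Complex

noncomputable section

namespace Literature.MathematicalPhysics.QuantumLattice

/-! ### Characters of finite sums -/

/-- `e^{2πi ∑ₐ fₐ} = ∏ₐ e^{2πi fₐ}`. [folklore] -/
theorem fourierChar_finset_sum {α : Type*} (s : Finset α) (f : α → ℝ) :
    ((𝐞 (∑ a ∈ s, f a) : Circle) : ℂ) = ∏ a ∈ s, ((𝐞 (f a) : Circle) : ℂ) := by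
  classical
  induction s using Finset.induction_on with
  | empty => simp
  | insert a s ha ih =>
    rw [Finset.sum_insert ha, Finset.prod_insert ha, AddChar.map_add_eq_mul, Circle.coe_mul, ih]

/-! ### Elementary interval arithmetic for affine box coordinates -/

/-- If `t ∈ [l, u]` (`l < u`) then `(t - l)/(u - l) ∈ [0, 1]`. [folklore] -/
theorem div_mem_Icc_zero_one {l u t : ℝ} (hlu : l < u) (ht : t ∈ Icc l u) :
    (t - l) / (u - l) ∈ Icc (0 : ℝ) 1 := by
  have h : 0 < u - l := sub_pos.2 hlu
  constructor
  · exact div_nonneg (by linarith [ht.1]) h.le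
  · rw [div_le_one h]; linarith [ht.2]

/-- If `t ∈ [l', u']` and `δ (u - l) ≤ l' - l`, `δ (u - l) ≤ u - u'` then
`(t - l)/(u - l) ∈ [δ, 1 - δ]`. [folklore] -/
theorem div_mem_Icc_of_margin {l u l' u' t δ : ℝ} (hlu : l < u) (hδ1 : δ * (u - l) ≤ l' - l)
    (hδ2 : δ * (u - l) ≤ u - u') (ht : t ∈ Icc l' u') :
    (t - l) / (u - l) ∈ Icc δ (1 - δ) := by
  have h : 0 < u - l := sub_pos.2 hlu
  constructor
  · rw [le_div_iff₀ h]; linarith [ht.1]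
  · rw [div_le_iff₀ h]; nlinarith [ht.2]

/-! ### Block box coordinates on `(Fin n → E)` -/

section Box

variable {E : Type*} [NormedAddCommGroup E] [NormedSpace ℝ E] [FiniteDimensional ℝ E]
variable {m n : ℕ} (Λ : E ≃L[ℝ] EuclideanSpace ℝ (Fin m))

/-- Scaled block coordinates: `v ↦ (Λ(vᵢ)_c / (u_{ic} - l_{ic}))_{(i,c)}`, a linear equivalence
`(Fin n → E) ≃ ℝ^{n × m}` (finite dimension makes it bicontinuous). [folklore] -/
def boxLinear (l u : Fin n × Fin m → ℝ) (hlu : ∀ ic, l ic < u ic) :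
    (Fin n → E) ≃ₗ[ℝ] EuclideanSpace ℝ (Fin n × Fin m) where
  toFun v := WithLp.toLp 2 fun ic => (Λ (v ic.1)) ic.2 / (u ic - l ic)
  invFun y := fun i => Λ.symm (WithLp.toLp 2 fun c => (u (i, c) - l (i, c)) * y (i, c))
  map_add' v v' := by
    ext ic
    simp [add_div]
  map_smul' r v := by
    ext ic
    simp [mul_div_assoc]
  left_inv v := by
    funext i
    have h : (WithLp.toLp 2 fun c => (u (i, c) - l (i, c)) *
        ((Λ (v i)) c / (u (i, c) - l (i, c)))) = Λ (v i) := by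
      ext c
      have hne : u (i, c) - l (i, c) ≠ 0 := (sub_pos.2 (hlu (i, c))).ne'
      field_simp
    change Λ.symm (WithLp.toLp 2 fun c => (u (i, c) - l (i, c)) *
        ((Λ (v i)) c / (u (i, c) - l (i, c)))) = v i
    rw [h, ContinuousLinearEquiv.symm_apply_apply]
  right_inv y := by
    ext ic
    have hne : u ic - l ic ≠ 0 := (sub_pos.2 (hlu ic)).ne'
    simp only [PiLp.toLp_apply, ContinuousLinearEquiv.apply_symm_apply]
    field_simp

/-- The block box coordinates as a continuous linear equivalence. [folklore] -/
def boxCoord (l u : Fin n × Fin m → ℝ) (hlu : ∀ ic, l ic < u ic) :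
    (Fin n → E) ≃L[ℝ] EuclideanSpace ℝ (Fin n × Fin m) :=
  (boxLinear Λ l u hlu).toContinuousLinearEquiv

/-- The shift of the affine box coordinates: `w_{ic} = -l_{ic} / (u_{ic} - l_{ic})`. [folklore] -/
def boxShift (l u : Fin n × Fin m → ℝ) : EuclideanSpace ℝ (Fin n × Fin m) :=
  WithLp.toLp 2 fun ic => -l ic / (u ic - l ic)

/-- The affine box coordinates are `y_{ic} = (Λ(vᵢ)_c - l_{ic}) / (u_{ic} - l_{ic})`, mapping the
box `∏ [l_{ic}, u_{ic}]` onto the unit cube. [folklore] -/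
theorem boxCoord_add_boxShift_apply (l u : Fin n × Fin m → ℝ) (hlu : ∀ ic, l ic < u ic)
    (v : Fin n → E) (ic : Fin n × Fin m) :
    (boxCoord Λ l u hlu v + boxShift l u) ic = ((Λ (v ic.1)) ic.2 - l ic) / (u ic - l ic) := by
  simp only [boxCoord, boxShift, LinearEquiv.coe_toContinuousLinearEquiv', PiLp.add_apply]
  change (Λ (v ic.1)) ic.2 / (u ic - l ic) + -l ic / (u ic - l ic) = _
  ring

end Box

/-! ### Cutoffs adapted to a box -/

section Cutoff

variable {E : Type*} [NormedAddCommGroup E] [NormedSpace ℝ E]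
variable {m n : ℕ} (Λ : E ≃L[ℝ] EuclideanSpace ℝ (Fin m))

/-- The data of two nested boxes in block coordinates: an inner closed box `∏ [l'_{ic}, u'_{ic}]`
strictly inside an outer open box `∏ (l_{ic}, u_{ic})`. [folklore] -/
structure BoxData (n m : ℕ) where
  /-- lower corner of the outer box -/
  l : Fin n × Fin m → ℝ
  /-- upper corner of the outer box -/
  u : Fin n × Fin m → ℝ
  /-- lower corner of the inner box -/
  l' : Fin n × Fin m → ℝ
  /-- upper corner of the inner box -/
  u' : Fin n × Fin m → ℝ
  hl : ∀ ic, l ic < l' ic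
  hl' : ∀ ic, l' ic ≤ u' ic
  hu : ∀ ic, u' ic < u ic

namespace BoxData

variable (B : BoxData n m)

/-- The outer box is nondegenerate: `l < u` coordinatewise. [folklore] -/
theorem hlu (ic : Fin n × Fin m) : B.l ic < B.u ic :=
  (B.hl ic).trans_le ((B.hl' ic).trans (B.hu ic).le)

/-- A third of the margin between the boxes. [folklore] -/
def eps (ic : Fin n × Fin m) : ℝ := min (B.l' ic - B.l ic) (B.u ic - B.u' ic) / 3

/-- The margin third `ε` is positive. [folklore] -/
theorem eps_pos (ic : Fin n × Fin m) : 0 < B.eps ic := by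
  unfold eps
  have h1 := B.hl ic; have h2 := B.hu ic
  have : 0 < min (B.l' ic - B.l ic) (B.u ic - B.u' ic) := lt_min (by linarith) (by linarith)
  linarith

/-- `2ε` is less than the left margin `l' - l`. [folklore] -/
theorem two_eps_lt_left (ic : Fin n × Fin m) : 2 * B.eps ic < B.l' ic - B.l ic := by
  unfold eps
  have h1 := B.hl ic
  have hmin := min_le_left (B.l' ic - B.l ic) (B.u ic - B.u' ic)
  nlinarith

/-- `2ε` is less than the right margin `u - u'`. [folklore] -/
theorem two_eps_lt_right (ic : Fin n × Fin m) : 2 * B.eps ic < B.u ic - B.u' ic := by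
  unfold eps
  have h2 := B.hu ic
  have hmin := min_le_right (B.l' ic - B.l ic) (B.u ic - B.u' ic)
  nlinarith

/-- One-dimensional smooth bump for the coordinate `ic`: equal to `1` on `[l', u']`, supported in
`[l' - 2ε, u' + 2ε] ⊆ (l, u)`. [folklore] -/
def bump (ic : Fin n × Fin m) : ContDiffBump ((B.l' ic + B.u' ic) / 2 : ℝ) where
  rIn := (B.u' ic - B.l' ic) / 2 + B.eps ic
  rOut := (B.u' ic - B.l' ic) / 2 + 2 * B.eps ic
  rIn_pos := by have := B.hl' ic; have := B.eps_pos ic; linarith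
  rIn_lt_rOut := by have := B.eps_pos ic; linarith

/-- The bump equals `1` on the inner interval `[l', u']`. [folklore] -/
theorem bump_eq_one {ic : Fin n × Fin m} {t : ℝ} (ht : t ∈ Icc (B.l' ic) (B.u' ic)) :
    (B.bump ic : ℝ → ℝ) t = 1 := by
  refine (B.bump ic).one_of_mem_closedBall ?_
  rw [Metric.mem_closedBall, Real.dist_eq]
  change |t - (B.l' ic + B.u' ic) / 2| ≤ (B.u' ic - B.l' ic) / 2 + B.eps ic
  have := B.eps_pos ic
  rw [abs_le]; constructor <;> linarith [ht.1, ht.2]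

/-- The closed coordinate interval containing the support of the bump. [folklore] -/
def K (ic : Fin n × Fin m) : Set ℝ := Icc (B.l' ic - 2 * B.eps ic) (B.u' ic + 2 * B.eps ic)

/-- The bump is supported in `K = [l' - 2ε, u' + 2ε]`. [folklore] -/
theorem tsupport_bump_subset (ic : Fin n × Fin m) : tsupport (B.bump ic : ℝ → ℝ) ⊆ B.K ic := by
  rw [(B.bump ic).tsupport_eq]
  intro t ht
  rw [Metric.mem_closedBall, Real.dist_eq] at ht
  change |t - (B.l' ic + B.u' ic) / 2| ≤ (B.u' ic - B.l' ic) / 2 + 2 * B.eps ic at ht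
  rw [abs_le] at ht
  simp only [K, mem_Icc]
  constructor <;> linarith [ht.1, ht.2]

/-- Points where the bump is nonzero lie in `K`. [folklore] -/
theorem bump_ne_zero_mem_K {ic : Fin n × Fin m} {t : ℝ} (ht : (B.bump ic : ℝ → ℝ) t ≠ 0) :
    t ∈ B.K ic :=
  B.tsupport_bump_subset ic (subset_tsupport _ ht)

/-- `K` lies in the open outer interval `(l, u)`. [folklore] -/
theorem K_subset_Ioo (ic : Fin n × Fin m) : B.K ic ⊆ Ioo (B.l ic) (B.u ic) := by
  intro t ht
  have h1 := B.two_eps_lt_left ic; have h2 := B.two_eps_lt_right ic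
  simp only [K, mem_Icc] at ht
  constructor <;> linarith [ht.1, ht.2]

/-- `K` lies in the closed outer interval `[l, u]`. [folklore] -/
theorem K_subset_Icc (ic : Fin n × Fin m) : B.K ic ⊆ Icc (B.l ic) (B.u ic) :=
  (B.K_subset_Ioo ic).trans Ioo_subset_Icc_self

/-- The cutoff on the `i`-th block: `Pᵢ(x) = ∏_c bump_{(i,c)}(Λ(x)_c)`. [folklore] -/
def cutFactor (i : Fin n) (x : E) : ℝ := ∏ c, (B.bump (i, c) : ℝ → ℝ) ((Λ x) c)

/-- The block coordinates `x ↦ Λ(x)_c` are smooth. [folklore] -/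
theorem contDiff_coord (c : Fin m) : ContDiff ℝ (⊤ : ℕ∞) (fun x : E => (Λ x) c) := by
  have h : (fun x : E => (Λ x) c) = (EuclideanSpace.proj (𝕜 := ℝ) c) ∘ Λ := by
    funext x; rfl
  rw [h]
  exact (EuclideanSpace.proj c).contDiff.comp Λ.contDiff

/-- The block cutoff `Pᵢ` is smooth. [folklore] -/
theorem contDiff_cutFactor (i : Fin n) : ContDiff ℝ (⊤ : ℕ∞) (B.cutFactor Λ i) := by
  unfold cutFactor
  exact contDiff_prod fun c _ => (B.bump (i, c)).contDiff.comp (contDiff_coord Λ c)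

/-- The closed block set containing the support of `Pᵢ`. [folklore] -/
def blockK (i : Fin n) : Set E := {x | ∀ c, (Λ x) c ∈ B.K (i, c)}

/-- The block set `blockK` is compact (a preimage of a product of compact intervals under `Λ`).
[folklore] -/
theorem isCompact_blockK (i : Fin n) : IsCompact (B.blockK Λ i) := by
  let Ψ : E ≃L[ℝ] (Fin m → ℝ) := Λ.trans (EuclideanSpace.equiv (Fin m) ℝ)
  have hK : IsCompact (Set.pi Set.univ fun c : Fin m => B.K (i, c)) :=
    isCompact_univ_pi fun c => isCompact_Icc
  have heq : B.blockK Λ i = Ψ ⁻¹' (Set.pi Set.univ fun c : Fin m => B.K (i, c)) := by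
    ext x
    simp only [blockK, mem_setOf_eq, mem_preimage, mem_univ_pi]
    rfl
  rw [heq]
  exact Ψ.toHomeomorph.isCompact_preimage.2 hK

/-- The block set `blockK` is closed. [folklore] -/
theorem isClosed_blockK (i : Fin n) : IsClosed (B.blockK Λ i) :=
  (B.isCompact_blockK Λ i).isClosed

/-- Points where `Pᵢ ≠ 0` lie in `blockK`. [folklore] -/
theorem cutFactor_ne_zero_mem_blockK {i : Fin n} {x : E} (hx : B.cutFactor Λ i x ≠ 0) :
    x ∈ B.blockK Λ i := by
  intro c
  exact B.bump_ne_zero_mem_K fun h0 => hx (Finset.prod_eq_zero (Finset.mem_univ c) h0)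

/-- `Pᵢ` is supported in `blockK`. [folklore] -/
theorem tsupport_cutFactor_subset (i : Fin n) : tsupport (B.cutFactor Λ i) ⊆ B.blockK Λ i :=
  closure_minimal (fun _ hx => B.cutFactor_ne_zero_mem_blockK Λ hx) (B.isClosed_blockK Λ i)

/-- `Pᵢ` has compact support. [folklore] -/
theorem hasCompactSupport_cutFactor (i : Fin n) : HasCompactSupport (B.cutFactor Λ i) :=
  IsCompact.of_isClosed_subset (B.isCompact_blockK Λ i) (isClosed_tsupport _)
    (B.tsupport_cutFactor_subset Λ i)

/-- `Pᵢ = 1` on the inner block. [folklore] -/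
theorem cutFactor_eq_one {i : Fin n} {x : E} (hx : ∀ c, (Λ x) c ∈ Icc (B.l' (i, c)) (B.u' (i, c))) :
    B.cutFactor Λ i x = 1 :=
  Finset.prod_eq_one fun c _ => B.bump_eq_one (hx c)

/-- The block cutoff as a real Schwartz function. [folklore] -/
def cutFactorS (i : Fin n) : 𝓢(E, ℝ) :=
  (B.hasCompactSupport_cutFactor Λ i).toSchwartzMap (B.contDiff_cutFactor Λ i)

/-- Evaluation of `cutFactorS`. [folklore] -/
@[simp]
theorem cutFactorS_apply (i : Fin n) (x : E) : B.cutFactorS Λ i x = B.cutFactor Λ i x := rfl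

/-- The full cutoff `P(v) = ∏ᵢ Pᵢ(vᵢ)` as a complex `n`-point test function. [folklore] -/
def cutoff : 𝓢((Fin n → E), ℂ) :=
  SchwartzMap.tensorFin n fun i => ofRealTest (B.cutFactorS Λ i)

/-- Evaluation of the full cutoff: `P(v) = ∏ᵢ Pᵢ(vᵢ)`. [folklore] -/
theorem cutoff_apply (v : Fin n → E) : B.cutoff Λ v = ∏ i, ((B.cutFactor Λ i (v i) : ℝ) : ℂ) := by
  rw [cutoff, SchwartzMap.tensorFin_apply]
  rfl

/-- The phase of the character `e_n` in the `i`-th block: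
`θᵢ(x) = ∑_c n_{ic} (Λ(x)_c - l_{ic}) / (u_{ic} - l_{ic})`. [folklore] -/
def phase (nn : Fin n × Fin m → ℤ) (i : Fin n) (x : E) : ℝ :=
  ∑ c, (nn (i, c) : ℝ) * (((Λ x) c - B.l (i, c)) / (B.u (i, c) - B.l (i, c)))

/-- The phase `θᵢ` is smooth (affine in the block coordinates). [folklore] -/
theorem contDiff_phase (nn : Fin n × Fin m → ℤ) (i : Fin n) : ContDiff ℝ (⊤ : ℕ∞) (B.phase Λ nn i) := by
  unfold phase
  refine ContDiff.sum fun c _ => contDiff_const.mul ?_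
  exact ((contDiff_coord Λ c).sub contDiff_const).div_const _

/-- The `i`-th factor of the term `P e_n`: `qᵢ(x) = Pᵢ(x) e^{2πi θᵢ(x)}`. [folklore] -/
def charFactor (nn : Fin n × Fin m → ℤ) (i : Fin n) (x : E) : ℂ :=
  ((B.cutFactor Λ i x : ℝ) : ℂ) * ((𝐞 (B.phase Λ nn i x) : Circle) : ℂ)

/-- The factor `qᵢ = Pᵢ e^{2πi θᵢ}` is smooth. [folklore] -/
theorem contDiff_charFactor (nn : Fin n × Fin m → ℤ) (i : Fin n) :
    ContDiff ℝ (⊤ : ℕ∞) (B.charFactor Λ nn i) := by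
  unfold charFactor
  refine (Complex.ofRealCLM.contDiff.comp (B.contDiff_cutFactor Λ i)).mul ?_
  exact contDiff_fourierChar.comp (B.contDiff_phase Λ nn i)

/-- The factor `qᵢ` has compact support (that of `Pᵢ`). [folklore] -/
theorem hasCompactSupport_charFactor (nn : Fin n × Fin m → ℤ) (i : Fin n) :
    HasCompactSupport (B.charFactor Λ nn i) := by
  unfold charFactor
  exact ((B.hasCompactSupport_cutFactor Λ i).comp_left Complex.ofReal_zero).mul_right

/-- `qᵢ` is supported in `blockK`. [folklore] -/
theorem tsupport_charFactor_subset (nn : Fin n × Fin m → ℤ) (i : Fin n) :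
    tsupport (B.charFactor Λ nn i) ⊆ B.blockK Λ i := by
  refine closure_minimal (fun x hx => B.cutFactor_ne_zero_mem_blockK Λ fun h0 => hx ?_)
    (B.isClosed_blockK Λ i)
  simp [charFactor, h0]

/-- The factors `qᵢ` as complex Schwartz functions. [folklore] -/
def charFactorS (nn : Fin n × Fin m → ℤ) (i : Fin n) : 𝓢(E, ℂ) :=
  (B.hasCompactSupport_charFactor Λ nn i).toSchwartzMap (B.contDiff_charFactor Λ nn i)

/-- Evaluation of `charFactorS`. [folklore] -/
@[simp]
theorem charFactorS_apply (nn : Fin n × Fin m → ℤ) (i : Fin n) (x : E) :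
    B.charFactorS Λ nn i x = B.charFactor Λ nn i x := rfl

/-- The terms `Q_n = P e_n = ⊗ᵢ qᵢ` of the Fourier expansion, as tensor products. [folklore] -/
def charTerm (nn : Fin n × Fin m → ℤ) : 𝓢((Fin n → E), ℂ) :=
  SchwartzMap.tensorFin n fun i => B.charFactorS Λ nn i

/-- The set of tensor products of real test functions supported in the blocks of the outer box.
[folklore] -/
def boxTensors : Set 𝓢((Fin n → E), ℂ) :=
  {G | ∃ g : Fin n → 𝓢(E, ℝ),
    (∀ i, tsupport (g i : E → ℝ) ⊆ {x | ∀ c, (Λ x) c ∈ Ioo (B.l (i, c)) (B.u (i, c))}) ∧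
      IsTensorOf G fun i => ofRealTest (g i)}

/-- Each term `Q_n = ⊗ᵢ qᵢ` lies in the span of `boxTensors`: expand every complex factor into
real and imaginary parts (`eq_sum_tensorFin_reIm`), all supported in the blocks of the outer box.
[folklore] -/
theorem charTerm_mem_span (nn : Fin n × Fin m → ℤ) :
    B.charTerm Λ nn ∈ Submodule.span ℂ (B.boxTensors Λ) := by
  have h := eq_sum_tensorFin_reIm (fun i => B.charFactorS Λ nn i) (B.charTerm Λ nn)
    (isTensorOf_tensorFin _)
  rw [h]
  refine Submodule.sum_mem _ fun t _ => Submodule.smul_mem _ _ (Submodule.subset_span ?_)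
  refine ⟨fun i => if i ∈ t then reTest (B.charFactorS Λ nn i) else imTest (B.charFactorS Λ nn i),
    fun i => ?_, isTensorOf_tensorFin _⟩
  have hblock : B.blockK Λ i ⊆ {x | ∀ c, (Λ x) c ∈ Ioo (B.l (i, c)) (B.u (i, c))} :=
    fun x hx c => B.K_subset_Ioo (i, c) (hx c)
  have hq : tsupport (B.charFactorS Λ nn i : E → ℂ) ⊆ B.blockK Λ i := B.tsupport_charFactor_subset Λ nn i
  dsimp only
  split_ifs
  · exact ((tsupport_reTest_subset _).trans hq).trans hblock
  · exact ((tsupport_imTest_subset _).trans hq).trans hblock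

variable [FiniteDimensional ℝ E]

/-- The terms `Q_n` are the cutoff times the characters in the affine box coordinates:
`Q_n(v) = P(v) e_n(Av + w)` (the witness form required by `tendsto_sum_boxCoeff_smul`). [folklore] -/
theorem charTerm_apply (nn : Fin n × Fin m → ℤ) (v : Fin n → E) :
    B.charTerm Λ nn v = B.cutoff Λ v * eChar nn (boxCoord Λ B.l B.u B.hlu v + boxShift B.l B.u) := by
  rw [charTerm, SchwartzMap.tensorFin_apply, cutoff_apply]
  simp only [charFactorS_apply, charFactor, Finset.prod_mul_distrib]
  congr 1
  rw [eChar, ← fourierChar_finset_sum]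
  congr 2
  rw [intForm_apply, Fintype.sum_prod_type (f := fun ic : Fin n × Fin m =>
    (nn ic : ℝ) * (boxCoord Λ B.l B.u B.hlu v + boxShift B.l B.u) ic)]
  refine Finset.sum_congr rfl fun i _ => ?_
  simp only [phase, boxCoord_add_boxShift_apply]


omit [FiniteDimensional ℝ E] in
/-- A uniform relative margin between the inner and the outer box: `δ > 0` with
`δ (u - l) ≤ l' - l` and `δ (u - l) ≤ u - u'` in every coordinate. [folklore] -/
theorem exists_margin : ∃ δ : ℝ, 0 < δ ∧ (∀ ic, δ * (B.u ic - B.l ic) ≤ B.l' ic - B.l ic) ∧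
    ∀ ic, δ * (B.u ic - B.l ic) ≤ B.u ic - B.u' ic := by
  let r : Fin n × Fin m → ℝ := fun ic =>
    min ((B.l' ic - B.l ic) / (B.u ic - B.l ic)) ((B.u ic - B.u' ic) / (B.u ic - B.l ic))
  have hr : ∀ ic, 0 < r ic := fun ic =>
    lt_min (div_pos (sub_pos.2 (B.hl ic)) (sub_pos.2 (B.hlu ic)))
      (div_pos (sub_pos.2 (B.hu ic)) (sub_pos.2 (B.hlu ic)))
  obtain ⟨δ, hδ, hδr⟩ : ∃ δ : ℝ, 0 < δ ∧ ∀ ic, δ ≤ r ic := by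
    rcases isEmpty_or_nonempty (Fin n × Fin m) with hι | hι
    · exact ⟨1 / 2, by norm_num, fun ic => (IsEmpty.false ic).elim⟩
    · refine ⟨Finset.univ.inf' Finset.univ_nonempty r, ?_, fun ic => Finset.inf'_le _ (Finset.mem_univ ic)⟩
      exact (Finset.lt_inf'_iff _).2 fun ic _ => hr ic
  refine ⟨δ, hδ, fun ic => ?_, fun ic => ?_⟩
  · have h := (hδr ic).trans (min_le_left _ _)
    rwa [le_div_iff₀ (sub_pos.2 (B.hlu ic))] at h
  · have h := (hδr ic).trans (min_le_right _ _)
    rwa [le_div_iff₀ (sub_pos.2 (B.hlu ic))] at h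

omit [FiniteDimensional ℝ E] in
/-- The support of the full cutoff lies in the product of the closed coordinate intervals `K`. [folklore] -/
theorem tsupport_cutoff_subset :
    tsupport (B.cutoff Λ : (Fin n → E) → ℂ) ⊆ {v | ∀ ic : Fin n × Fin m, (Λ (v ic.1)) ic.2 ∈ B.K ic} := by
  have hcl : IsClosed {v : Fin n → E | ∀ ic : Fin n × Fin m, (Λ (v ic.1)) ic.2 ∈ B.K ic} := by
    simp only [setOf_forall]
    refine isClosed_iInter fun ic => ?_
    exact (isClosed_Icc).preimage
      (((EuclideanSpace.proj ic.2).continuous.comp Λ.continuous).comp (continuous_apply ic.1))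
  refine closure_minimal (fun v hv ic => ?_) hcl
  rw [Function.mem_support, BoxData.cutoff_apply] at hv
  have hi : B.cutFactor Λ ic.1 (v ic.1) ≠ 0 := fun h0 =>
    hv (Finset.prod_eq_zero (Finset.mem_univ ic.1) (by rw [h0, Complex.ofReal_zero]))
  exact B.cutFactor_ne_zero_mem_blockK Λ hi ic.2

omit [FiniteDimensional ℝ E] in
/-- The full cutoff equals `1` on the inner box. [folklore] -/
theorem cutoff_eq_one {v : Fin n → E}
    (hv : ∀ ic : Fin n × Fin m, (Λ (v ic.1)) ic.2 ∈ Icc (B.l' ic) (B.u' ic)) : B.cutoff Λ v = 1 := by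
  rw [BoxData.cutoff_apply]
  exact Finset.prod_eq_one fun i _ => by
    rw [B.cutFactor_eq_one Λ fun c => hv (i, c), Complex.ofReal_one]

end BoxData

variable [FiniteDimensional ℝ E]

/-- **Local density theorem.** Let `Λ : E ≃ ℝᵐ` be linear coordinates on the finite-dimensional
one-point space `E`, and let `F ∈ 𝓢(Eⁿ, ℂ)` be supported in a closed box `∏ [l'_{ic}, u'_{ic}]`
(in the block coordinates `Λ(vᵢ)_c`) lying strictly inside an open box `∏ (l_{ic}, u_{ic})`.
Then `F` belongs to the closure, in `𝓢(Eⁿ, ℂ)`, of the `ℂ`-span of the tensor products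
`g₁ ⊗ ⋯ ⊗ gₙ` of *real* test functions `gᵢ ∈ 𝓢(E, ℝ)` supported in the blocks
`{x | ∀ c, Λ(x)_c ∈ (l_{ic}, u_{ic})}` of the outer box. Proof: expand `F` in a multiple Fourier
series on the outer box after multiplication by a product cutoff
(`tendsto_sum_boxCoeff_smul`); every term `P e_n = ⊗ᵢ Pᵢ e_{nᵢ}` is a tensor product of complex
compactly supported functions, i.e. a combination of `2ⁿ` real tensor products
(`eq_sum_tensorFin_reIm`). This is the classical proof that `C_c^∞(X) ⊗ C_c^∞(Y)` is dense in
`C_c^∞(X × Y)` (Schwartz kernel theorem; OS 1973 §2). [folklore] -/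
theorem mem_closure_span_boxTensors (B : BoxData n m) (F : 𝓢((Fin n → E), ℂ))
    (hF : tsupport (F : (Fin n → E) → ℂ) ⊆
      {v | ∀ ic : Fin n × Fin m, (Λ (v ic.1)) ic.2 ∈ Icc (B.l' ic) (B.u' ic)}) :
    F ∈ closure (Submodule.span ℂ (B.boxTensors Λ) : Set 𝓢((Fin n → E), ℂ)) := by
  obtain ⟨δ, hδ, hδ1, hδ2⟩ := B.exists_margin
  -- hypotheses of the engine
  have hG : ∀ v ∈ tsupport (F : (Fin n → E) → ℂ), ∀ ic,
      (boxCoord Λ B.l B.u B.hlu v + boxShift B.l B.u) ic ∈ Icc δ (1 - δ) := by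
    intro v hv ic
    rw [boxCoord_add_boxShift_apply]
    exact div_mem_Icc_of_margin (B.hlu ic) (hδ1 ic) (hδ2 ic) (hF hv ic)
  have hP1 : ∀ v ∈ tsupport (F : (Fin n → E) → ℂ), B.cutoff Λ v = 1 := fun v hv =>
    B.cutoff_eq_one Λ fun ic => hF hv ic
  have hP0 : ∀ v ∈ tsupport (B.cutoff Λ : (Fin n → E) → ℂ), ∀ ic,
      (boxCoord Λ B.l B.u B.hlu v + boxShift B.l B.u) ic ∈ Icc (0 : ℝ) 1 := by
    intro v hv ic
    rw [boxCoord_add_boxShift_apply]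
    exact div_mem_Icc_zero_one (B.hlu ic) (B.K_subset_Icc ic (B.tsupport_cutoff_subset Λ hv ic))
  have hlim := tendsto_sum_boxCoeff_smul (boxCoord Λ B.l B.u B.hlu) (boxShift B.l B.u) hδ F
    (B.cutoff Λ) hG hP1 hP0 (B.charTerm Λ) (B.charTerm_apply Λ)
  refine mem_closure_of_tendsto hlim (Eventually.of_forall fun s => ?_)
  exact Submodule.sum_mem _ fun nn _ => Submodule.smul_mem _ _ (B.charTerm_mem_span Λ nn)

end Cutoff

/-! ### Density of tensor products in `𝓢(Eⁿ)` -/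

section Density

variable {E : Type*} [NormedAddCommGroup E] [NormedSpace ℝ E]
variable {m n : ℕ}

/-- The box tensor products are tensor products of real test functions. [folklore] -/
theorem BoxData.boxTensors_subset_tensorProducts (Λ : E ≃L[ℝ] EuclideanSpace ℝ (Fin m))
    (B : BoxData n m) : B.boxTensors Λ ⊆ tensorProducts n :=
  fun _ ⟨g, _, hG⟩ => ⟨g, hG⟩

/-- Coordinates of points of a ball are bounded: if `‖v‖ ≤ R` then `|Λ(vᵢ)_c| ≤ ‖Λ‖ R`. [folklore] -/
theorem abs_coord_le (Λ : E ≃L[ℝ] EuclideanSpace ℝ (Fin m)) {R : ℝ} {v : Fin n → E}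
    (hv : ‖v‖ ≤ R) (i : Fin n) (c : Fin m) :
    |(Λ (v i)) c| ≤ ‖(Λ : E →L[ℝ] EuclideanSpace ℝ (Fin m))‖ * R := by
  calc |(Λ (v i)) c| = ‖(Λ (v i)) c‖ := (Real.norm_eq_abs _).symm
    _ ≤ ‖Λ (v i)‖ := PiLp.norm_apply_le _ _
    _ ≤ ‖(Λ : E →L[ℝ] EuclideanSpace ℝ (Fin m))‖ * ‖v i‖ := Λ.toContinuousLinearMap.le_opNorm _
    _ ≤ ‖(Λ : E →L[ℝ] EuclideanSpace ℝ (Fin m))‖ * R := by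
        gcongr
        exact (norm_le_pi_norm v i).trans hv

/-- **Density of tensor products of real test functions** (discharge of
`denseSpan_tensorProducts`, Reed–Simon I Thm V.13 / OS 1973 §2 `𝒮(ℝ^{4n}) = ⊗̂ⁿ 𝒮(ℝ⁴)`): for a
finite-dimensional real normed space `E` and every `n`, the `ℂ`-span of the tensor products
`f₁ ⊗ ⋯ ⊗ fₙ` of complexified real test functions `fᵢ ∈ 𝓢(E, ℝ)` is dense in `𝓢(Eⁿ, ℂ)`.
Proof: compactly supported test functions are dense (`exists_tsupport_subset_closedBall_tendsto`),
and a compactly supported one lies in the closure of the span by the local density theorem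
`mem_closure_span_boxTensors` (Fourier series in a box). [cite: ReedSimonI1980, Thm V.13] -/
theorem denseSpan_tensorProducts_holds : denseSpan_tensorProducts (E := E) := by
  intro _ n
  set m : ℕ := Module.finrank ℝ E with hm
  have hfin : Module.finrank ℝ E = Module.finrank ℝ (EuclideanSpace ℝ (Fin m)) := by simp [hm]
  let Λ : E ≃L[ℝ] EuclideanSpace ℝ (Fin m) := ContinuousLinearEquiv.ofFinrankEq hfin
  rw [dense_iff_closure_eq]
  refine Set.eq_univ_of_forall fun F => ?_
  obtain ⟨useq, hu, hlim⟩ := exists_tsupport_subset_closedBall_tendsto F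
  rw [← closure_closure]
  refine mem_closure_of_tendsto hlim (Eventually.of_forall fun k => ?_)
  set R : ℝ := ‖(Λ : E →L[ℝ] EuclideanSpace ℝ (Fin m))‖ * (2 * ((k : ℝ) + 1)) with hR
  have hR0 : 0 ≤ R := by positivity
  let B : BoxData n m :=
    { l := fun _ => -R - 1, u := fun _ => R + 1, l' := fun _ => -R, u' := fun _ => R
      hl := fun _ => by linarith, hl' := fun _ => by linarith, hu := fun _ => by linarith }
  have hF : tsupport (useq k : (Fin n → E) → ℂ) ⊆
      {v | ∀ ic : Fin n × Fin m, (Λ (v ic.1)) ic.2 ∈ Icc (B.l' ic) (B.u' ic)} := by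
    intro v hv ic
    have hvR : ‖v‖ ≤ 2 * ((k : ℝ) + 1) := mem_closedBall_zero_iff.1 (hu k hv)
    exact abs_le.1 (abs_coord_le Λ hvR ic.1 ic.2)
  exact closure_mono (Submodule.span_mono (B.boxTensors_subset_tensorProducts Λ))
    (mem_closure_span_boxTensors Λ B (useq k) hF)


/-- **E3 for the Schwinger functions of a measure** (discharge of
`IsSchwingerFamilyOf.isSymmetric`, OS 1973 §3 (E3); Glimm–Jaffe §6.1): from the density of tensor
products (`isSymmetric_of_denseSpan`). [cite: OsterwalderSchraderCMP1973, §3 (E3)] -/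
theorem IsSchwingerFamilyOf.isSymmetric_holds : IsSchwingerFamilyOf.isSymmetric (E := E) :=
  IsSchwingerFamilyOf.isSymmetric_of_denseSpan denseSpan_tensorProducts_holds

/-- **E1 for the Schwinger functions of a Euclidean-invariant measure** (discharge of
`IsSchwingerFamilyOf.isEuclideanCovariant`, OS 1973 §3 (E1); Glimm–Jaffe §6.1 OS2): from the
density of tensor products (`isEuclideanCovariant_of_denseSpan`). [cite: OsterwalderSchraderCMP1973, §3 (E1)] -/
theorem IsSchwingerFamilyOf.isEuclideanCovariant_holds :
    IsSchwingerFamilyOf.isEuclideanCovariant (E := E) :=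
  IsSchwingerFamilyOf.isEuclideanCovariant_of_denseSpan denseSpan_tensorProducts_holds

/-- **Uniqueness of the Schwinger family of a measure** (the uniqueness half of the kernel
theorem, Reed–Simon I Thm V.12; Glimm–Jaffe §6.1 Prop. 6.1.4): two Schwinger families of the same
measure coincide. [cite: ReedSimonI1980, Thm V.12 (uniqueness)] -/
theorem IsSchwingerFamilyOf.unique [FiniteDimensional ℝ E] {μ : MeasureTheory.Measure (FieldConfig E)}
    {S S' : SchwingerFamily E} (hS : IsSchwingerFamilyOf μ S) (hS' : IsSchwingerFamilyOf μ S') :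
    S = S' :=
  hS.unique_of_denseSpan denseSpan_tensorProducts_holds hS'

end Density

/-! ### Density of positive-time tensor products in the positive-time `n`-point functions -/

section PositiveTime

variable {d : ℕ} [NeZero d] {n : ℕ}

/-- The support of a time translate `F(· - a)` by `a = T e₀` (in every argument) of a
positive-time `n`-point function lies in `{∀ i, xᵢ⁰ ≥ T}`. [folklore] -/
theorem tsupport_translateMulti_single_subset {F : 𝓢((Fin n → EuclideanSpace ℝ (Fin d)), ℂ)}
    (hF : IsPositiveTimeMulti F) (T : ℝ) :
    tsupport (translateMulti (EuclideanSpace.single (0 : Fin d) T) F :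
        (Fin n → EuclideanSpace ℝ (Fin d)) → ℂ) ⊆ {v | ∀ i, T ≤ v i 0} := by
  have hcl : IsClosed {v : Fin n → EuclideanSpace ℝ (Fin d) | ∀ i, T ≤ v i 0} := by
    simp only [setOf_forall]
    exact isClosed_iInter fun i => isClosed_le continuous_const
      (((EuclideanSpace.proj (0 : Fin d)).continuous).comp (continuous_apply i))
  refine closure_minimal (fun v hv i => ?_) hcl
  rw [Function.mem_support, translateMulti_apply] at hv
  have hmem := hF (subset_tsupport _ hv) i
  simp only [PiLp.sub_apply, PiLp.single_apply, if_true] at hmem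
  linarith

/-- Time translates converge: `F(· - T e₀) → F` in `𝓢` as `T = 1/(k+1) → 0` (strong continuity
of translations, `continuous_compSubConstCLM`). [folklore] -/
theorem tendsto_translateMulti_single (F : 𝓢((Fin n → EuclideanSpace ℝ (Fin d)), ℂ)) :
    Tendsto (fun k : ℕ => translateMulti (EuclideanSpace.single (0 : Fin d) (1 / ((k : ℝ) + 1))) F)
      atTop (𝓝 F) := by
  have hT : Tendsto (fun k : ℕ => 1 / ((k : ℝ) + 1)) atTop (𝓝 0) := tendsto_one_div_add_atTop_nhds_zero_nat
  have ha : Tendsto (fun k : ℕ => fun _ : Fin n => EuclideanSpace.single (0 : Fin d) (1 / ((k : ℝ) + 1)))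
      atTop (𝓝 (fun _ : Fin n => (0 : EuclideanSpace ℝ (Fin d)))) := by
    refine tendsto_pi_nhds.2 fun _ => ?_
    have h0 : EuclideanSpace.single (0 : Fin d) (0 : ℝ) = (0 : EuclideanSpace ℝ (Fin d)) := by
      ext j; simp
    rw [← h0]
    have hc : Continuous fun t : ℝ => (EuclideanSpace.single (0 : Fin d) t : EuclideanSpace ℝ (Fin d)) := by
      change Continuous fun t : ℝ => WithLp.toLp 2 (Pi.single (M := fun _ : Fin d => ℝ) 0 t)
      exact (PiLp.continuous_toLp 2 _).comp (continuous_single (A := fun _ : Fin d => ℝ) 0 :)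
    exact (hc.tendsto 0).comp hT
  have hcont := (continuous_compSubConstCLM ℂ F).tendsto (fun _ : Fin n => (0 : EuclideanSpace ℝ (Fin d)))
  have h0 : SchwartzMap.compSubConstCLM ℂ (fun _ : Fin n => (0 : EuclideanSpace ℝ (Fin d))) F = F := by
    ext v
    have hv : (v - fun _ : Fin n => (0 : EuclideanSpace ℝ (Fin d))) = v := funext fun i => by simp
    simp [hv]
  rw [h0] at hcont
  exact hcont.comp ha

/-- **Density of positive-time tensor products** (discharge of
`IsPositiveTimeMulti.mem_closure_span_positiveTensorProducts`; OS 1973 §2,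
`𝒮(ℝ^{4n}₊) = ⊗̂ₙ 𝒮(ℝ⁴₊)` in the open-wedge variant): every `n`-point test function supported in
the open wedge `{∀ i, xᵢ⁰ > 0}` is a limit of finite combinations of tensor products of real
one-point test functions supported at positive times. Proof: translate `F` slightly forward in
time (`F(· - T e₀) → F`, `T → 0`), which produces a uniform margin `xᵢ⁰ ≥ T`; cut off at
infinity (`exists_tsupport_subset_inter_closedBall_tendsto`, the cutoffs staying inside
`tsupport`); the resulting functions are supported in closed boxes with `xᵢ⁰ ∈ [T, R]`, strictly
inside open boxes with `xᵢ⁰ > T/2 > 0`, to which the local density theorem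
`mem_closure_span_boxTensors` applies, its real factors being positive-time. [cite: OsterwalderSchraderCMP1973, §2 pp. 86–87] -/
theorem IsPositiveTimeMulti.mem_closure_span_positiveTensorProducts_holds :
    IsPositiveTimeMulti.mem_closure_span_positiveTensorProducts (d := d) := by
  intro n F hF
  set C : Set 𝓢((Fin n → EuclideanSpace ℝ (Fin d)), ℂ) :=
    closure (Submodule.span ℂ (positiveTensorProducts (d := d) n) : Set _) with hCdef
  have hC : IsClosed C := isClosed_closure
  -- step 1: forward time translates
  refine hC.mem_of_tendsto (tendsto_translateMulti_single F) (Eventually.of_forall fun k => ?_)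
  set T : ℝ := 1 / ((k : ℝ) + 1) with hTdef
  have hT0 : 0 < T := by positivity
  have hT1 : T ≤ 1 := by
    rw [hTdef, div_le_one (by positivity)]; linarith [(k.cast_nonneg : (0 : ℝ) ≤ k)]
  set FT := translateMulti (EuclideanSpace.single (0 : Fin d) T) F with hFT
  have hFTsupp := tsupport_translateMulti_single_subset hF T
  -- step 2: compact cutoffs inside `tsupport FT`
  obtain ⟨u, hu, hlim⟩ := exists_tsupport_subset_inter_closedBall_tendsto FT
  refine hC.mem_of_tendsto hlim (Eventually.of_forall fun j => ?_)
  -- step 3: the boxes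
  set R : ℝ := 2 * ((j : ℝ) + 1) with hRdef
  have hR2 : 2 ≤ R := by rw [hRdef]; linarith [(j.cast_nonneg : (0 : ℝ) ≤ j)]
  let B : BoxData n d :=
    { l := fun ic => if ic.2 = 0 then T / 2 else -R - 1
      u := fun _ => R + 1
      l' := fun ic => if ic.2 = 0 then T else -R
      u' := fun _ => R
      hl := fun ic => by split_ifs <;> linarith
      hl' := fun ic => by split_ifs <;> linarith
      hu := fun _ => by linarith }
  let Λ : EuclideanSpace ℝ (Fin d) ≃L[ℝ] EuclideanSpace ℝ (Fin d) := ContinuousLinearEquiv.refl ℝ _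
  have hF' : tsupport (u j : (Fin n → EuclideanSpace ℝ (Fin d)) → ℂ) ⊆
      {v | ∀ ic : Fin n × Fin d, (Λ (v ic.1)) ic.2 ∈ Icc (B.l' ic) (B.u' ic)} := by
    intro v hv ic
    have hv' := hu j hv
    have hvR : ‖v‖ ≤ R := mem_closedBall_zero_iff.1 hv'.2
    have habs : |(v ic.1) ic.2| ≤ R :=
      calc |(v ic.1) ic.2| = ‖(v ic.1) ic.2‖ := (Real.norm_eq_abs _).symm
        _ ≤ ‖v ic.1‖ := PiLp.norm_apply_le _ _
        _ ≤ ‖v‖ := norm_le_pi_norm v ic.1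
        _ ≤ R := hvR
    change (v ic.1) ic.2 ∈ Icc (if ic.2 = 0 then T else -R) R
    split_ifs with h0
    · refine ⟨?_, (le_abs_self _).trans habs⟩
      have := hFTsupp hv'.1 ic.1
      rw [h0]; exact this
    · exact abs_le.1 habs
  have hmem := mem_closure_span_boxTensors Λ B (u j) hF'
  refine closure_mono (Submodule.span_mono ?_) hmem
  rintro G ⟨g, hg, hG⟩
  refine ⟨g, fun i => ?_, hG⟩
  intro x hx
  have h := hg i hx 0
  change x 0 ∈ Ioo (if (0 : Fin d) = 0 then T / 2 else -R - 1) (R + 1) at h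
  rw [if_pos rfl] at h
  change 0 < x 0
  linarith [h.1]

end PositiveTime

end Literature.MathematicalPhysics.QuantumLattice
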